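import Summits.FinalStateConjecture.FinalStateConjecture.Theorems.TameCensorship.Negative.NullTerminalityUniformityProfile
import Literature.Geometry.Lorentzian.Hypersurface
import Literature.Geometry.Lorentzian.ChartSecondFundamentalForm
import Literature.Geometry.Lorentzian.IsometryProofs

/-!
# Null terminality needs UNIFORM contraction — part 2/3: the graph immersion and its second fundamental form
(negative-side result for crux `TameCensorship`, `stmt-FinalStateConjecture-10047`; cdisprove seat, cycle 3;
see part 3/3 `NullTerminalityNeedsUniformity.lean`)

* the graph immersion `fGraph y = u(y⁰) e₀ + (0, y) : E3 → E4`, its differential `dfGraph`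
  (`η(df v, df w) = ⟪v, w⟫ − u'² v⁰ w⁰`), the unit normal field `Nf = (1 − u'²)^{−1/2}(e₀ + u' e₁)`
  (`η(N, df v) = 0`, `η(N, N) = −1`, `η(e₀, N) < 0`), smoothness of the lift `y ↦ (f y, ν y) ∈ TE4`;
* `normalDerivAlong_flat : D_v ν = D(Nf)_y v` — the model-space reading of the tree's frame formula
  `normalDerivAlong_eq` in the flat development (constant frame, `∇ ∂ᵢ = 0`);
* `secondFundamentalForm_graph : K_ν(v, w) = c u'' v⁰ w⁰` (via `secondFundamentalForm_apply_holds`).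
-/

noncomputable section

open Bundle Set Filter Function Topology
open scoped Manifold ContDiff InnerProductSpace

namespace Summit.FinalStateConjecture.FinalStateConjecture.Theorems.TameCensorship.Negative

open Literature.Geometry.Lorentzian

/-! ## S5 The immersion `f(y) = (u(y⁰), y)`, its tangent vectors, its unit normal field -/

/-- The spatial embedding `y ↦ (0, y)` as a continuous linear map `E3 →L[ℝ] E4`. -/
def sEmb : E3 →L[ℝ] E4 :=
  ∑ i : Fin 3, (EuclideanSpace.proj i : E3 →L[ℝ] ℝ).smulRight (E4.basisVector i.succ)

/-- `(0, y)` has time component `0`. -/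
@[simp] theorem sEmb_apply_zero (y : E3) : sEmb y 0 = 0 := by
  simp [sEmb, Fin.sum_univ_three]

/-- `(0, y)` has spatial components `y`. -/
@[simp] theorem sEmb_apply_succ (y : E3) (i : Fin 3) : sEmb y i.succ = y i := by
  fin_cases i <;> simp [sEmb, Fin.sum_univ_three, Fin.ext_iff]

/-- The graph immersion `f(y) = u(y⁰) e₀ + (0, y)`. -/
def fGraph (y : E3) : E4 := uprof (y 0) • E4.basisVector 0 + sEmb y

/-- Time component of the graph point: `u(y⁰)`. -/
@[simp] theorem fGraph_apply_zero (y : E3) : fGraph y 0 = uprof (y 0) := by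
  simp [fGraph]

/-- Spatial components of the graph point: `y`. -/
@[simp] theorem fGraph_apply_succ (y : E3) (i : Fin 3) : fGraph y i.succ = y i := by
  simp [fGraph, Fin.succ_ne_zero]

/-- The differential of the graph map at `y`: `v ↦ (u'(y⁰) v⁰) e₀ + (0, v)`. -/
def dfGraph (y : E3) : E3 →L[ℝ] E4 :=
  ((uderiv (y 0)) • (EuclideanSpace.proj (0 : Fin 3) : E3 →L[ℝ] ℝ)).smulRight (E4.basisVector 0) + sEmb

/-- `df_y v = (u'(y⁰) v⁰) e₀ + (0, v)`. -/
theorem dfGraph_apply (y v : E3) : dfGraph y v = (uderiv (y 0) * v 0) • E4.basisVector 0 + sEmb v := by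
  simp [dfGraph]

/-- Time component of `df_y v`. -/
@[simp] theorem dfGraph_apply_zero (y v : E3) : dfGraph y v 0 = uderiv (y 0) * v 0 := by
  rw [dfGraph_apply]; simp

/-- Spatial components of `df_y v`. -/
@[simp] theorem dfGraph_apply_succ (y v : E3) (i : Fin 3) : dfGraph y v i.succ = v i := by
  rw [dfGraph_apply]; simp [Fin.succ_ne_zero]

/-- The graph map has derivative `dfGraph`. -/
theorem hasFDerivAt_fGraph (y : E3) : HasFDerivAt fGraph (dfGraph y) y := by
  have h0 : HasFDerivAt (fun y : E3 ↦ y 0) (EuclideanSpace.proj (0 : Fin 3) : E3 →L[ℝ] ℝ) y :=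
    (EuclideanSpace.proj (0 : Fin 3) : E3 →L[ℝ] ℝ).hasFDerivAt
  have h1' := (hasDerivAt_uprof (y 0)).comp_hasFDerivAt y h0
  have h1 : HasFDerivAt (fun y : E3 ↦ uprof (y 0))
      ((uderiv (y 0)) • (EuclideanSpace.proj (0 : Fin 3) : E3 →L[ℝ] ℝ)) y := by
    simpa only [Function.comp_def] using h1'
  have h2 := h1.smul_const (E4.basisVector 0)
  exact h2.add sEmb.hasFDerivAt

/-- The graph map is differentiable. -/
theorem differentiable_fGraph : Differentiable ℝ fGraph := fun y ↦ (hasFDerivAt_fGraph y).differentiableAt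

/-- `fderiv` of the graph map. -/
theorem fderiv_fGraph (y : E3) : fderiv ℝ fGraph y = dfGraph y := (hasFDerivAt_fGraph y).fderiv

/-- The graph map is smooth (any order). -/
theorem contDiff_fGraph {m : ℕ∞ω} : ContDiff ℝ m fGraph := by
  unfold fGraph
  have h0 : ContDiff ℝ m (fun y : E3 ↦ y 0) := contDiff_piLp_apply (p := 2) (i := (0 : Fin 3))
  exact ((contDiff_uprof.comp h0).smul contDiff_const).add sEmb.contDiff

/-- `η(df v, df w) = ⟪v, w⟫ − u'² v⁰ w⁰`. -/
theorem bilin_dfGraph (y v w : E3) :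
    Minkowski.bilin (dfGraph y v) (dfGraph y w) = ⟪v, w⟫_ℝ - uderiv (y 0) ^ 2 * (v 0 * w 0) := by
  rw [Minkowski.bilin_apply]
  simp only [dfGraph_apply_zero, dfGraph_apply_succ]
  have : ⟪v, w⟫_ℝ = ∑ i : Fin 3, v i * w i := by
    rw [EuclideanSpace.inner_eq_star_dotProduct]
    simp [dotProduct, Fin.sum_univ_three, mul_comm]
  rw [this]
  ring

/-- Positivity of the induced form: `η(df v, df v) ≥ (1 − u'²)‖v‖² > 0` for `v ≠ 0`. -/
theorem bilin_dfGraph_self_pos (y : E3) {v : E3} (hv : v ≠ 0) :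
    0 < Minkowski.bilin (dfGraph y v) (dfGraph y v) := by
  rw [bilin_dfGraph, real_inner_self_eq_norm_sq]
  have h1 : v 0 ^ 2 ≤ ‖v‖ ^ 2 := by
    have := abs_apply_le_norm_E3 v 0
    calc v 0 ^ 2 = |v 0| ^ 2 := (sq_abs _).symm
      _ ≤ ‖v‖ ^ 2 := pow_le_pow_left₀ (abs_nonneg _) this 2
  have h2 : 0 < ‖v‖ ^ 2 := by positivity
  have h3 := uderiv_sq_lt_one (y 0)
  have h4 : 0 ≤ uderiv (y 0) ^ 2 := sq_nonneg _
  nlinarith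

/-- The raw normal `n(r) = e₀ + u'(r) e₁` and the unit normal `N(r) = c(r) n(r)`. -/
def nraw (r : ℝ) : E4 := E4.basisVector 0 + uderiv r • E4.basisVector 1

/-- The unit normal `N(r) = c(r) n(r)` as a function of `r = y⁰`. -/
def nvec (r : ℝ) : E4 := cfac r • nraw r

/-- The normal field along `fGraph`: `ν(y) = N(y⁰)`. -/
def Nf (y : E3) : E4 := nvec (y 0)

/-- Time component of the raw normal. -/
@[simp] theorem nraw_apply_zero (r : ℝ) : nraw r 0 = 1 := by simp [nraw]
/-- `x¹`-component of the raw normal. -/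
@[simp] theorem nraw_apply_one (r : ℝ) : nraw r 1 = uderiv r := by simp [nraw]
/-- `x²`-component of the raw normal. -/
@[simp] theorem nraw_apply_two (r : ℝ) : nraw r 2 = 0 := by simp [nraw, Fin.ext_iff]
/-- `x³`-component of the raw normal. -/
@[simp] theorem nraw_apply_three (r : ℝ) : nraw r 3 = 0 := by simp [nraw, Fin.ext_iff]

/-- `η(n, df v) = 0`: the raw normal is normal. -/
theorem bilin_nraw_dfGraph (y v : E3) : Minkowski.bilin (nraw (y 0)) (dfGraph y v) = 0 := by
  rw [Minkowski.bilin_apply]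
  simp [Fin.sum_univ_three, Fin.succ_zero_eq_one, Fin.succ_one_eq_two]

/-- `η(n, n) = −(1 − u'²)`. -/
theorem bilin_nraw_nraw (r : ℝ) : Minkowski.bilin (nraw r) (nraw r) = -(1 - uderiv r ^ 2) := by
  rw [Minkowski.bilin_apply]
  simp [Fin.sum_univ_three, Fin.succ_zero_eq_one, Fin.succ_one_eq_two]
  ring

/-- `η(N, df v) = 0`: `N` is normal to the graph. -/
theorem bilin_Nf_dfGraph (y v : E3) : Minkowski.bilin (Nf y) (dfGraph y v) = 0 := by
  unfold Nf nvec
  simp only [map_smul, FunLike.coe_smul, Pi.smul_apply, bilin_nraw_dfGraph, smul_zero]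

/-- `η(N, N) = −1`: `N` is a timelike unit vector. -/
theorem bilin_Nf_Nf (y : E3) : Minkowski.bilin (Nf y) (Nf y) = -1 := by
  unfold Nf nvec
  simp only [map_smul, FunLike.coe_smul, Pi.smul_apply, smul_eq_mul, bilin_nraw_nraw]
  have := cfac_sq_mul (y 0)
  nlinarith [this]

/-- `η(e₀, N) = −c < 0`: the normal is future-directed. -/
theorem bilin_e0_Nf (y : E3) : Minkowski.bilin (E4.basisVector 0) (Nf y) < 0 := by
  rw [Minkowski.bilin_basisVector_zero_left]
  unfold Nf nvec
  simp [cfac_pos (y 0)]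


/-! ## S6 The derivative of the normal field; the second fundamental form in the flat development -/

/-- `n' = u'' e₁`. -/
theorem hasDerivAt_nraw (r : ℝ) : HasDerivAt nraw (uderiv2 r • E4.basisVector 1) r := by
  unfold nraw
  have h := ((hasDerivAt_uderiv r).smul_const (E4.basisVector 1)).const_add (E4.basisVector 0)
  exact h

/-- `N' = c n' + c' n` (the value of `c'` is never needed). -/
def nvecDeriv (r : ℝ) : E4 := cfac r • (uderiv2 r • E4.basisVector 1) + deriv cfac r • nraw r

/-- `N' = nvecDeriv`. -/
theorem hasDerivAt_nvec (r : ℝ) : HasDerivAt nvec (nvecDeriv r) r :=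
  ((differentiable_cfac r).hasDerivAt).smul (hasDerivAt_nraw r)

/-- `N` is differentiable. -/
theorem differentiable_nvec : Differentiable ℝ nvec := fun r ↦ (hasDerivAt_nvec r).differentiableAt

/-- The normal field has derivative `v ↦ v⁰ N'(y⁰)`. -/
theorem hasFDerivAt_Nf (y : E3) :
    HasFDerivAt Nf ((EuclideanSpace.proj (0 : Fin 3) : E3 →L[ℝ] ℝ).smulRight (nvecDeriv (y 0))) y := by
  have h0 : HasFDerivAt (fun y : E3 ↦ y 0) (EuclideanSpace.proj (0 : Fin 3) : E3 →L[ℝ] ℝ) y :=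
    (EuclideanSpace.proj (0 : Fin 3) : E3 →L[ℝ] ℝ).hasFDerivAt
  have h1 := ((hasDerivAt_nvec (y 0)).hasFDerivAt).comp y h0
  have h2 : HasFDerivAt (fun y : E3 ↦ nvec (y 0))
      ((EuclideanSpace.proj (0 : Fin 3) : E3 →L[ℝ] ℝ).smulRight (nvecDeriv (y 0))) y := by
    refine h1.congr_fderiv ?_
    ext v
    simp
  exact h2

/-- The normal field is differentiable. -/
theorem differentiable_Nf : Differentiable ℝ Nf := fun y ↦ (hasFDerivAt_Nf y).differentiableAt

/-- `D(Nf)_y v = v⁰ N'(y⁰)`. -/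
theorem fderiv_Nf_apply (y v : E3) : fderiv ℝ Nf y v = (v 0) • nvecDeriv (y 0) := by
  rw [(hasFDerivAt_Nf y).fderiv]
  simp

/-- `η(N', df w) = c u'' w⁰` (normality `η(n, df w) = 0` kills the `c'` term; `η(e₁, df w) = w⁰`). -/
theorem bilin_nvecDeriv_dfGraph (y w : E3) :
    Minkowski.bilin (nvecDeriv (y 0)) (dfGraph y w) = cfac (y 0) * uderiv2 (y 0) * w 0 := by
  unfold nvecDeriv
  rw [map_add]
  simp only [map_smul, add_apply, FunLike.coe_smul, Pi.smul_apply,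
    smul_eq_mul, bilin_nraw_dfGraph, mul_zero, add_zero]
  have : Minkowski.bilin (E4.basisVector 1) (dfGraph y w) = w 0 := by
    rw [Minkowski.bilin_apply]
    simp [Fin.sum_univ_three, Fin.succ_zero_eq_one, Fin.succ_one_eq_two]
  rw [this]
  ring

section Flat

local notation "gη" => (Minkowski.smoothMetric.toPseudoRiemannianMetric :
  PseudoRiemannianMetric 𝓘(ℝ, E4) ∞ E4 (TangentSpace 𝓘(ℝ, E4) : E4 → Type _))

variable [Minkowski.smoothMetric.toPseudoRiemannianMetric.HasLeviCivita]

/-- The normal field along the graph, as a field of tangent vectors of the development. -/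
def νf : NormalField 𝓘(ℝ, E4) fGraph := fun y ↦ (Nf y : E4)

omit [Minkowski.smoothMetric.toPseudoRiemannianMetric.HasLeviCivita] in
/-- The graph map is differentiable as a map of manifolds. -/
theorem mdifferentiableAt_fGraph (y : E3) : MDifferentiableAt 𝓘(ℝ, E3) 𝓘(ℝ, E4) fGraph y :=
  mdifferentiableAt_iff_differentiableAt.mpr (differentiable_fGraph y)

omit [Minkowski.smoothMetric.toPseudoRiemannianMetric.HasLeviCivita] in
/-- `mfderiv` of the graph map is `dfGraph`. -/
theorem mfderiv_fGraph (y : E3) : mfderiv 𝓘(ℝ, E3) 𝓘(ℝ, E4) fGraph y = dfGraph y := by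
  rw [mfderiv_eq_fderiv, fderiv_fGraph]

omit [Minkowski.smoothMetric.toPseudoRiemannianMetric.HasLeviCivita] in
/-- The lift `y ↦ (f y, ν y) ∈ TE4` is differentiable (trivial tangent bundle of the model space). -/
theorem mdifferentiableAt_lift (y : E3) :
    MDifferentiableAt 𝓘(ℝ, E3) 𝓘(ℝ, E4).tangent
      (fun x ↦ (TotalSpace.mk' E4 (fGraph x) (νf x) : TangentBundle 𝓘(ℝ, E4) E4)) y := by
  refine (mdifferentiableAt_totalSpace _ _).2 ⟨mdifferentiableAt_fGraph y, ?_⟩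
  simp only [trivializationAt_model_space_apply]
  exact mdifferentiableAt_iff_differentiableAt.mpr (differentiable_Nf y)

omit [Minkowski.smoothMetric.toPseudoRiemannianMetric.HasLeviCivita] in
/-- The lift `y ↦ (f y, ν y) ∈ TE4` is smooth. -/
theorem contMDiff_lift :
    ContMDiff 𝓘(ℝ, E3) 𝓘(ℝ, E4).tangent ∞
      (fun x ↦ (TotalSpace.mk' E4 (fGraph x) (νf x) : TangentBundle 𝓘(ℝ, E4) E4)) := by
  have hf : ContMDiff 𝓘(ℝ, E3) 𝓘(ℝ, E4) ∞ fGraph := contMDiff_iff_contDiff.mpr contDiff_fGraph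
  have hN : ContMDiff 𝓘(ℝ, E3) 𝓘(ℝ, E4) ∞ Nf := by
    refine contMDiff_iff_contDiff.mpr ?_
    unfold Nf nvec cfac nraw
    have h0 : ContDiff ℝ ∞ (fun y : E3 ↦ y 0) := contDiff_piLp_apply (p := 2) (i := (0 : Fin 3))
    have hc : ContDiff ℝ ∞ (fun r : ℝ ↦ (Real.sqrt (1 - uderiv r ^ 2))⁻¹) := by
      refine ContDiff.inv ?_ fun r ↦ (Real.sqrt_pos.mpr (one_sub_uderiv_sq_pos r)).ne'
      exact (contDiff_const.sub (contDiff_uderiv.pow 2)).sqrt fun r ↦ (one_sub_uderiv_sq_pos r).ne'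
    have hn : ContDiff ℝ ∞ (fun r : ℝ ↦ E4.basisVector 0 + uderiv r • E4.basisVector 1) :=
      contDiff_const.add (contDiff_uderiv.smul contDiff_const)
    exact (hc.comp h0).smul (hn.comp h0)
  intro y
  rw [contMDiffAt_totalSpace]
  refine ⟨hf y, ?_⟩
  simp only [trivializationAt_model_space_apply]
  exact hN y

/-- **`D_v ν = DN(y) v` in the flat development** (the model-space reading of the frame formula
`normalDerivAlong_eq`: constant frame, constant coefficient functionals, `∇ ∂ᵢ = 0`). -/
theorem normalDerivAlong_flat (y : E3) (v : E3) :
    PseudoRiemannianMetric.normalDerivAlong (I' := 𝓘(ℝ, E3)) gη fGraph νf y v = fderiv ℝ Nf y v := by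
  have hlift := mdifferentiableAt_lift y
  rw [PseudoRiemannianMetric.normalDerivAlong_eq gη (I' := 𝓘(ℝ, E3))
    BoundarylessManifold.isInteriorPoint hlift v]
  set b := Module.finBasis ℝ E4 with hb
  have h1 : ∀ i, mfderiv 𝓘(ℝ, E3) 𝓘(ℝ, ℝ) (fun x : E3 ↦
      (trivializationAt E4 (TangentSpace 𝓘(ℝ, E4) : E4 → Type _) (fGraph y)).localFrame_coeff
        𝓘(ℝ, E4) b i (fGraph x) (νf x)) y v = b.repr (fderiv ℝ Nf y v) i := by
    intro i
    set L : E4 →L[ℝ] ℝ := LinearMap.toContinuousLinearMap (b.coord i) with hL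
    have hrep : (fun x : E3 ↦ (trivializationAt E4 (TangentSpace 𝓘(ℝ, E4) : E4 → Type _)
        (fGraph y)).localFrame_coeff 𝓘(ℝ, E4) b i (fGraph x) (νf x)) = L ∘ Nf := by
      funext x
      rw [Function.comp_apply, ModelSpace.localFrame_coeff_trivializationAt]
      rfl
    have hd : HasFDerivAt (L ∘ Nf) (L.comp (fderiv ℝ Nf y)) y :=
      L.hasFDerivAt.comp _ (differentiable_Nf y).hasFDerivAt
    rw [hrep, mfderiv_eq_fderiv, hd.fderiv]
    rfl
  have h2 : ∀ i, (trivializationAt E4 (TangentSpace 𝓘(ℝ, E4) : E4 → Type _) (fGraph y)).localFrame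
      b i (fGraph y) = b i := fun i ↦ by
    rw [ModelSpace.localFrame_trivializationAt]
  have h4 : ∀ i, PseudoRiemannianMetric.leviCivita gη ((trivializationAt E4
      (TangentSpace 𝓘(ℝ, E4) : E4 → Type _) (fGraph y)).localFrame b i) (fGraph y)
        (mfderiv 𝓘(ℝ, E3) 𝓘(ℝ, E4) fGraph y v) = 0 := fun i ↦ by
    rw [ModelSpace.localFrame_trivializationAt,
      ModelSpace.leviCivita_const (g := gη) Minkowski.smoothMetric_val (fGraph y) (b i)]
    rfl
  refine Eq.trans (b := ∑ i, (b.repr (fderiv ℝ Nf y v) i) • (b i : E4) +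
    ∑ _i : Fin (Module.finrank ℝ E4), (0 : E4)) ?_ ?_
  · congr 1
    · refine Finset.sum_congr rfl fun i _ ↦ ?_
      rw [h2 i]
      exact congrArg (fun c : ℝ ↦ c • (b i : E4)) (h1 i)
    · refine Finset.sum_congr rfl fun i _ ↦ ?_
      rw [h4 i, smul_zero]
      rfl
  · rw [b.sum_repr, Finset.sum_const_zero, add_zero]

/-- **The second fundamental form of the graph**: `K_ν(v, w) = η(DN(y) v, df_y w) = c u'' v⁰ w⁰`. -/
theorem secondFundamentalForm_graph (y : E3) (v w : E3) :
    PseudoRiemannianMetric.secondFundamentalForm 𝓘(ℝ, E3) gη fGraph νf y v w =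
      cfac (y 0) * uderiv2 (y 0) * (v 0 * w 0) := by
  rw [PseudoRiemannianMetric.secondFundamentalForm_apply_holds (g := gη) (I' := 𝓘(ℝ, E3))
    BoundarylessManifold.isInteriorPoint (mdifferentiableAt_lift y) v w,
    normalDerivAlong_flat, mfderiv_fGraph, fderiv_Nf_apply]
  show Minkowski.bilin ((v 0) • nvecDeriv (y 0)) (dfGraph y w) = _
  rw [map_smul, FunLike.coe_smul, Pi.smul_apply, smul_eq_mul, bilin_nvecDeriv_dfGraph]
  ring


end Flat

end Summit.FinalStateConjecture.FinalStateConjecture.Theorems.TameCensorship.Negative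

end
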